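import Literature.NumberTheory.LFunctions.AlternativeHypothesis
import HarnessLib

/-!
# Band-limited mimicry of the Poisson and sine processes by point processes supported on a
# lattice `aℤ` (Lagarias–Rodgers, Ann. Appl. Probab. 31 (2021)): Theorem 1.6, Corollary 1.7,
# Theorem 1.8, Corollary 1.9

Topic `Literature/Probability/PointProcesses` (namespace `Literature.Probability.PointProcesses`;
paper-specific objects in the sub-namespace `LagariasRodgers2021`). STATEMENT LAYER for cell
`landau-siegel` §C (reader r2: zero spacing ↔ exceptional zero): the companion paper of
Lagarias–Rodgers, *Higher correlations and the Alternative Hypothesis* (Q. J. Math. 71 (2020),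
typed as `Literature.NumberTheory.LFunctions.lagariasRodgers2020_theorem31` in
`AlternativeHypothesis.lean`). Nothing here concerns the zeros of `ζ` directly: the theorems are
statements about abstract point processes; their number-theoretic reading (LR21 §1.8: the zeta
case is the lattice–bandwidth pair `(a, B) = (1/2, 1)`, "on the boundary of mimicry for the sine
process, and even a slight perturbation off this lattice spacing or bandwidth would no longer
allow for it") is recorded in the docstrings only.

## What the source prints (held text `paper:arxiv-1907.03391`, 3000-character chunks pNNNN)

* §1.2 (p0003): a point configuration is a locally finite sequence of points of `𝔛 = ℝ` or `aℤ`,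
  repeated values allowed and counted with multiplicity; `#_V(u)` = number of points in `V`.
  **Uniform local moments (u.l.m.)**: "For each `n ≥ 1` there exists a constant `C_n < ∞` such
  that `𝔼[(#_{[L,L+1]}(u))ⁿ] ≤ C_n` for all `L ∈ ℝ`." The `n`-level correlation measure `ρ_n` is
  defined by `𝔼 Σ^{distinct}_{j_1,…,j_n} φ(u_{j_1},…,u_{j_n}) = ∫ φ dρ_n` (sum over ordered `n`-tuples
  of pairwise distinct INDICES), first for `φ ∈ C_c(ℝⁿ)` and then (Proposition 1.1, p0003–p0004)
  for Schwartz `η`, the sum converging almost surely to an integrable random variable.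
* §1.3 (p0004), Fourier convention `η̂(ξ) = ∫ η(x) e(−x·ξ) dx`, `e(y) = e^{2πiy}` (= Mathlib's `𝓕`).
  **Definition 1.3**: "Let `u` and `v` be u.l.m. point processes in `ℝ`, and let `B > 0`. Suppose
  that for each `n ≥ 1` and all `η ∈ 𝒮(ℝⁿ)` whose Fourier transform `η̂` is supported in `[−B,B]ⁿ`,
  we have `𝔼 Σ^{distinct} η(u_{j_1},…,u_{j_n}) = 𝔼 Σ^{distinct} η(v_{j_1},…,v_{j_n})`. Then we say that
  `v` mimics `u` at the bandwidth `[−B, B]`." "A point process is said to be supported on `aℤ` if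
  all configurations lie in `aℤ`." Neither process is required to be simple.
* §1.5 (p0005): the Poisson process of intensity `λ` is the unique point process with
  `𝔼 Σ^{distinct} φ(w_{j_1},…,w_{j_n}) = ∫_{ℝⁿ} φ(x) λⁿ dⁿx`; the sine process is the unique point process
  with `𝔼 Σ^{distinct} φ(z_{j_1},…,z_{j_n}) = ∫_{ℝⁿ} φ(x) det_{n×n}[S(x_i − x_j)] dⁿx`, `S(x) = sin πx/(πx)`
  (`S(0) = 1`), for all `n ≥ 1` and `φ ∈ C_c(ℝⁿ)` ("for `n = 1` … the meaning `∫_ℝ φ(x_1) dx_1`").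
* **Theorem 1.6** (p0006:L20–26) "Let `λ > 0` be arbitrary. For all `a > 0`, if `B ≤ 1/a`, then
  the Poisson process with intensity `λ` can be mimicked at bandwidth `[−B, B]` by a u.l.m. point
  process supported on `aℤ`. For all `a > 0`, if `B > 1/a`, then the Poisson process with
  intensity `λ` cannot be mimicked at bandwidth `[−B, B]` by a u.l.m. point process supported on
  `aℤ`." **Corollary 1.7** (p0006:L28–30): mimicry of Poisson(`λ`) at the Nyquist bandwidth
  `[−1/(2a), 1/(2a)]` for each `a > 0`.
* **Theorem 1.8** (p0006:L36–46) "(i) For all `0 < a ≤ 1`, if `B ≤ (1−a)/a`, then the sine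
  process can be mimicked at bandwidth `[−B, B]` by a u.l.m. point process supported on `aℤ`.
  (ii) For all `0 < a ≤ 1/2`, if `B > (1−a)/a`, then the sine process cannot be mimicked at
  bandwidth `[−B, B]` by a u.l.m. point process supported on `aℤ`. (iii) If `a > 1/2` and
  `B ≥ 1/(2a)`, then the sine process cannot be mimicked at bandwidth `[−B, B]` by a u.l.m. point
  process supported on `aℤ`." **Corollary 1.9** (p0006:L48–50): "The sine process can be
  mimicked by a u.l.m. point process supported on `aℤ` at the Nyquist bandwidth
  `[−1/(2a), 1/(2a)]` if and only if `0 < a ≤ 1/2`."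

## Lean rendering / design choices

* Only LATTICE-SUPPORTED processes are ever quantified over in Theorems 1.6/1.8 (the Poisson and
  sine processes enter through their explicit correlation densities alone), so a point process
  supported on `aℤ` is encoded by its random SITE MULTIPLICITIES `N : Ω → ℤ → ℕ` (the site `k`
  carries the point `a·k` with multiplicity `N ω k`) on a probability space `(Ω, ℙ)`, each
  `ω ↦ N ω k` measurable (this generates exactly LR's cylinder σ-algebra on configurations in the
  discrete space `aℤ`). Local finiteness is automatic. LR index configurations by `ℤ`; finite
  configurations are intended too (their Remark 1.2), and are allowed here.
* `Σ^{distinct}` over ordered `n`-tuples of distinct indices becomes, for a multiplicity field `N`,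
  the lattice sum `Σ_{k ∈ ℤⁿ} W_N(k) · η(a k)` with the falling-factorial weight
  `W_N(k) = ∏_{s ∈ range k} (N s)(N s − 1)⋯(N s − r_s + 1)`, `r_s = #{i : k_i = s}`
  (`LagariasRodgers2021.tupleWeight`; it is the number of ways to choose distinct particles at the
  prescribed sites, and reproduces LR's (1.5) `Σ^{distinct} ∏ 1_V(u_{j_i}) = ∏_{i<n}(#_V(u) − i)`).
  The sum is a `tsum` and the expectation a Bochner integral: for u.l.m. processes and Schwartz `η`
  Proposition 1.1 of the source gives almost-sure absolute convergence and integrability, so on the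
  class of processes appearing in the theorems (all u.l.m.) the rendering agrees with print.
* u.l.m. is rendered with the extended (`ℝ≥0∞`-valued) integral of `(#_{[L,L+1]})ⁿ` bounded by a
  FINITE constant, so that heavy tails are not hidden by a junk Bochner value; `n` ranges over all
  naturals (`n = 0` is trivially satisfied, so this is the printed condition).
* "mimics the sine process at bandwidth `[−B,B]`" is rendered DIRECTLY by the sine process's printed
  correlation densities: for every `n ≥ 1` and every Schwartz `η` on `ℝⁿ` with
  `supp η̂ ⊆ [−B, B]ⁿ`, `𝔼 Σ^{distinct} η = ∫ η(x) det[S(x_i − x_j)] dⁿx` — the right-hand side is the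
  tree's `Literature.NumberTheory.LFunctions.LagariasRodgers2020.sineDeterminantIntegral`
  (not re-declared); likewise Poisson(`λ`) by `λⁿ ∫ η`. `ℝⁿ = EuclideanSpace ℝ (Fin n)`, `η̂ = 𝓕 η`.
* Existence statements quantify `∃ (Ω : Type) …`; non-existence statements are universe
  polymorphic in `Ω`.
* PROVED here (no new facts beyond the five theorem clauses): Corollary 1.9 from Theorem 1.8
  (i)+(iii) and Corollary 1.7 from Theorem 1.6 (i) (stated as theorems taking the clauses as
  hypotheses), the two `a = 1/2` specialisations of Theorem 1.8 that constitute the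
  number-theoretic knife edge (`½ℤ` mimics the sine process at bandwidth `1`, and at no bandwidth
  `B > 1`), monotonicity of mimicry in the bandwidth, and small API for the tuple weight.

## Deliberately NOT here

* Theorems 1.4 and 1.5 (uniqueness of the mimicking correlation measures above the Nyquist
  bandwidth; no `ℝ`-translation-invariant u.l.m. process is mimicked on `aℤ` above `B = 1/a`) —
  they quantify over general point processes on `ℝ`, which needs correlation measures of
  non-lattice configurations. TODO(general form): encode configurations as counting measures
  (`Literature/Probability/Process/PointStationaryLaw.lean` style) with factorial moment measures.
* The discrete sine process (LR21 Theorem 4.1) and all proofs (§§2–4); Proposition 1.1.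
* Any statement about zeros of `ζ` or the Alternative Hypothesis (see `AlternativeHypothesis.lean`).
-/

noncomputable section

open _root_.MeasureTheory Filter Set
open scoped Real Topology FourierTransform ENNReal NNReal

namespace Literature.Probability.PointProcesses

universe u

namespace LagariasRodgers2021

variable {Ω : Type u} [MeasurableSpace Ω]

/-! ## §1. Lattice-supported point processes: counts, u.l.m., the distinct-tuple sum -/

/-- The lattice sites of `aℤ` lying in the window `[L, L+1]`: `{k ∈ ℤ : L ≤ a k ≤ L + 1}` as the
integer interval `[⌈L/a⌉, ⌊(L+1)/a⌋]` (for `a > 0`). [cite: LagariasRodgers2021, §1.2 (u.l.m. condition)] -/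
def windowSites (a L : ℝ) : Finset ℤ :=
  Finset.Icc ⌈L / a⌉ ⌊(L + 1) / a⌋

/-- For `a > 0`, `k ∈ windowSites a L ↔ a·k ∈ [L, L+1]`. [cite: LagariasRodgers2021, §1.2 (u.l.m. condition)] -/
theorem mem_windowSites {a L : ℝ} (ha : 0 < a) {k : ℤ} :
    k ∈ windowSites a L ↔ L ≤ a * k ∧ a * k ≤ L + 1 := by
  simp only [windowSites, Finset.mem_Icc, Int.ceil_le, Int.le_floor]
  constructor
  · rintro ⟨h1, h2⟩
    exact ⟨by rwa [div_le_iff₀ ha, mul_comm] at h1, by rwa [le_div_iff₀ ha, mul_comm] at h2⟩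
  · rintro ⟨h1, h2⟩
    exact ⟨by rwa [div_le_iff₀ ha, mul_comm], by rwa [le_div_iff₀ ha, mul_comm]⟩

/-- `#_{[L,L+1]}(u)` for a configuration of `aℤ` with site multiplicities `N`: the number of points,
with multiplicity, in the window `[L, L+1]`. [cite: LagariasRodgers2021, §1.2 (u.l.m. condition)] -/
def windowCount (a : ℝ) (N : ℤ → ℕ) (L : ℝ) : ℕ :=
  ∑ k ∈ windowSites a L, N k

/-- **A (not necessarily simple) point process supported on the lattice `aℤ` with uniform local
moments** (LR21 §1.2–1.3): random site multiplicities `N : Ω → ℤ → ℕ` on the probability space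
`(Ω, ℙ)` (site `k` carries the point `a k` with multiplicity `N ω k`), each count measurable, and
"for each `n ≥ 1` there exists a constant `C_n < ∞` such that `𝔼[(#_{[L,L+1]}(u))ⁿ] ≤ C_n` for all
`L ∈ ℝ`" (stated with the `ℝ≥0∞`-valued integral and a finite bound, for every `n : ℕ`).
[cite: LagariasRodgers2021, §1.2–§1.3 (u.l.m. point process supported on aZ)] -/
def IsULMLatticeProcess (ℙ : Measure Ω) (a : ℝ) (N : Ω → ℤ → ℕ) : Prop :=
  IsProbabilityMeasure ℙ ∧ (∀ k : ℤ, Measurable fun ω ↦ N ω k) ∧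
    ∀ n : ℕ, ∃ C : ℝ≥0, ∀ L : ℝ, ∫⁻ ω, ((windowCount a (N ω) L : ℝ≥0∞)) ^ n ∂ℙ ≤ C

/-- The falling-factorial weight of a site tuple `k : Fin n → ℤ` for multiplicities `N`:
`W_N(k) = ∏_{s ∈ range k} N(s)·(N(s)−1)⋯(N(s)−r_s+1)`, `r_s = #{i : k i = s}` — the number of
ordered choices of pairwise distinct PARTICLES (points counted with multiplicity) occupying the
sites `k 0, …, k (n−1)` in order. Summing `W_N(k) η(a k)` over `k ∈ ℤⁿ` is LR's
`Σ^{distinct}_{j_1,…,j_n} η(u_{j_1},…,u_{j_n})` for the configuration with multiplicities `N`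
(cf. their (1.5): `Σ^{distinct} ∏_i 1_V(u_{j_i}) = ∏_{i<n} (#_V(u) − i)`).
[cite: LagariasRodgers2021, §1.2 (1.4)–(1.5)] -/
def tupleWeight {n : ℕ} (N : ℤ → ℕ) (k : Fin n → ℤ) : ℕ :=
  ∏ s ∈ Finset.univ.image k, (N s).descFactorial (Finset.univ.filter fun i ↦ k i = s).card

/-- `Σ^{distinct}_{j_1,…,j_n} η(u_{j_1},…,u_{j_n})` for a configuration of `aℤ` with site multiplicities
`N`, as the lattice sum `Σ_{k ∈ ℤⁿ} W_N(k) η(a k_1, …, a k_n)` (a `tsum`; absolutely convergent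
almost surely for u.l.m. processes and Schwartz `η` by LR21 Proposition 1.1).
[cite: LagariasRodgers2021, §1.2 Prop 1.1] -/
def distinctSum (n : ℕ) (a : ℝ) (N : ℤ → ℕ) (η : EuclideanSpace ℝ (Fin n) → ℂ) : ℂ :=
  ∑' k : Fin n → ℤ, (tupleWeight N k : ℂ) * η (WithLp.toLp 2 fun i ↦ a * (k i : ℝ))

/-- The band-limited Schwartz test functions of bandwidth `[−B, B]` on `ℝⁿ`: `η ∈ 𝒮(ℝⁿ)` "whose
Fourier transform `η̂` is supported in `[−B,B]ⁿ`" (`η̂ = 𝓕 η`, Mathlib's `e(−x·ξ)` convention = LR's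
§1.3). [cite: LagariasRodgers2021, Def 1.3] -/
def IsBandLimited (n : ℕ) (B : ℝ) (η : SchwartzMap (EuclideanSpace ℝ (Fin n)) ℂ) : Prop :=
  tsupport (𝓕 (⇑η)) ⊆ {ξ : EuclideanSpace ℝ (Fin n) | ∀ i, |ξ i| ≤ B}

/-- Shrinking the bandwidth shrinks the test class: band-limited at `B' ≤ B` implies band-limited
at `B`. [cite: LagariasRodgers2021, Def 1.3] -/
theorem IsBandLimited.mono {n : ℕ} {B B' : ℝ} (h : B' ≤ B)
    {η : SchwartzMap (EuclideanSpace ℝ (Fin n)) ℂ} (hη : IsBandLimited n B' η) :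
    IsBandLimited n B η :=
  fun _ hξ i ↦ (hη hξ i).trans h

/-! ## §2. Mimicry of the sine process and of the Poisson process (Definition 1.3, §1.5) -/

/-- **The lattice process `(ℙ, N)` on `aℤ` mimics the SINE PROCESS at the bandwidth `[−B, B]`**
(LR21 Definition 1.3 with `u` = the sine process, whose correlation measures are
`det_{n×n}[S(x_i − x_j)] dⁿx`, §1.5.2): for each `n ≥ 1` and every Schwartz `η` on `ℝⁿ` with
`supp η̂ ⊆ [−B,B]ⁿ`, `𝔼 Σ^{distinct} η(u_{j_1},…,u_{j_n}) = ∫_{ℝⁿ} η(x) det[S(x_i − x_j)] dⁿx` (the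
tree's `LagariasRodgers2020.sineDeterminantIntegral`; for `n = 1` this is `∫ η`).
[cite: LagariasRodgers2021, Def 1.3 and §1.5.2 (1.13)] -/
def MimicsSine (ℙ : Measure Ω) (a B : ℝ) (N : Ω → ℤ → ℕ) : Prop :=
  ∀ n : ℕ, 1 ≤ n → ∀ η : SchwartzMap (EuclideanSpace ℝ (Fin n)) ℂ, IsBandLimited n B η →
    ∫ ω, distinctSum n a (N ω) ⇑η ∂ℙ =
      Literature.NumberTheory.LFunctions.LagariasRodgers2020.sineDeterminantIntegral n ⇑η

/-- **The lattice process `(ℙ, N)` on `aℤ` mimics the POISSON PROCESS of intensity `λ` at the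
bandwidth `[−B, B]`** (LR21 Definition 1.3 with `u` = Poisson(`λ`), correlation measures `λⁿ dⁿx`,
§1.5.1): for each `n ≥ 1` and every Schwartz `η` on `ℝⁿ` with `supp η̂ ⊆ [−B,B]ⁿ`,
`𝔼 Σ^{distinct} η = λⁿ ∫_{ℝⁿ} η(x) dⁿx`. [cite: LagariasRodgers2021, Def 1.3 and §1.5.1 (1.12)] -/
def MimicsPoisson (ℙ : Measure Ω) (lam a B : ℝ) (N : Ω → ℤ → ℕ) : Prop :=
  ∀ n : ℕ, 1 ≤ n → ∀ η : SchwartzMap (EuclideanSpace ℝ (Fin n)) ℂ, IsBandLimited n B η →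
    ∫ ω, distinctSum n a (N ω) ⇑η ∂ℙ =
      (lam : ℂ) ^ n * ∫ x : EuclideanSpace ℝ (Fin n), η x

/-- Mimicry is monotone in the bandwidth: a process mimicking the sine process at `[−B, B]` mimics
it at every smaller bandwidth `[−B', B']`, `B' ≤ B` (the test class shrinks).
[cite: LagariasRodgers2021, Def 1.3] -/
theorem MimicsSine.anti {ℙ : Measure Ω} {a B B' : ℝ} {N : Ω → ℤ → ℕ} (h : MimicsSine ℙ a B N)
    (hB : B' ≤ B) : MimicsSine ℙ a B' N :=
  fun n hn η hη ↦ h n hn η (hη.mono hB)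

/-- Mimicry of the Poisson process is monotone in the bandwidth. [cite: LagariasRodgers2021, Def 1.3] -/
theorem MimicsPoisson.anti {ℙ : Measure Ω} {lam a B B' : ℝ} {N : Ω → ℤ → ℕ}
    (h : MimicsPoisson ℙ lam a B N) (hB : B' ≤ B) : MimicsPoisson ℙ lam a B' N :=
  fun n hn η hη ↦ h n hn η (hη.mono hB)

/-- **"The sine process can be mimicked at bandwidth `[−B, B]` by a u.l.m. point process supported
on `aℤ`"** (the existential clause of LR21 Theorems 1.8 (i) / Corollary 1.9): there are a
probability space and random site multiplicities on `aℤ` forming a u.l.m. lattice process that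
mimics the sine process at `[−B, B]`. [cite: LagariasRodgers2021, §1.3 (Band-limited Mimicry Problem)] -/
def SineMimickedOn (a B : ℝ) : Prop :=
  ∃ (Ω : Type) (_ : MeasurableSpace Ω) (ℙ : Measure Ω) (N : Ω → ℤ → ℕ),
    IsULMLatticeProcess ℙ a N ∧ MimicsSine ℙ a B N

/-- **"The Poisson process with intensity `λ` can be mimicked at bandwidth `[−B, B]` by a u.l.m.
point process supported on `aℤ`"** (existential clause of LR21 Theorem 1.6 / Corollary 1.7).
[cite: LagariasRodgers2021, §1.3 (Band-limited Mimicry Problem)] -/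
def PoissonMimickedOn (lam a B : ℝ) : Prop :=
  ∃ (Ω : Type) (_ : MeasurableSpace Ω) (ℙ : Measure Ω) (N : Ω → ℤ → ℕ),
    IsULMLatticeProcess ℙ a N ∧ MimicsPoisson ℙ lam a B N

end LagariasRodgers2021

open LagariasRodgers2021

/-! ## §3. The theorems (named facts) -/

/-- **Lagarias–Rodgers 2021, Theorem 1.6, first part (Poisson mimicry up to twice Nyquist).**
"Let `λ > 0` be arbitrary. For all `a > 0`, if `B ≤ 1/a`, then the Poisson process with intensity
`λ` can be mimicked at bandwidth `[−B, B]` by a u.l.m. point process supported on `aℤ`." (`B > 0`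
as in Definition 1.3.) NAMED FACT (proof: the discrete Poisson process and Poisson summation,
LR21 §3). [cite: LagariasRodgers2021, Thm 1.6] -/
def lagariasRodgers2021_theorem16_i : Prop :=
  ∀ lam : ℝ, 0 < lam → ∀ a : ℝ, 0 < a → ∀ B : ℝ, 0 < B → B ≤ 1 / a → PoissonMimickedOn lam a B

/-- **Lagarias–Rodgers 2021, Theorem 1.6, second part.** "For all `a > 0`, if `B > 1/a`, then the
Poisson process with intensity `λ` cannot be mimicked at bandwidth `[−B, B]` by a u.l.m. point
process supported on `aℤ`" — stated for lattice processes on probability spaces in an arbitrary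
universe. NAMED FACT (proof: LR21 Theorem 1.5, §2.3). [cite: LagariasRodgers2021, Thm 1.6] -/
def lagariasRodgers2021_theorem16_ii : Prop :=
  ∀ lam : ℝ, 0 < lam → ∀ a : ℝ, 0 < a → ∀ B : ℝ, 1 / a < B →
    ∀ (Ω : Type u) (_ : MeasurableSpace Ω) (ℙ : Measure Ω) (N : Ω → ℤ → ℕ),
      IsULMLatticeProcess ℙ a N → ¬ MimicsPoisson ℙ lam a B N

/-- **Lagarias–Rodgers 2021, Theorem 1.8 (i) (sine-process mimicry exists below `(1−a)/a`).**
"For all `0 < a ≤ 1`, if `B ≤ (1−a)/a`, then the sine process can be mimicked at bandwidth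
`[−B, B]` by a u.l.m. point process supported on `aℤ`." (`B > 0` as in Definition 1.3.) NAMED FACT
(proof: the discrete sine process on `aℤ`, LR21 Theorem 4.1 and §4.2). The zeta-relevant case is
`a = 1/2`, `B = 1` (`sineMimickedOn_half_one`). [cite: LagariasRodgers2021, Thm 1.8] -/
def lagariasRodgers2021_theorem18_i : Prop :=
  ∀ a : ℝ, 0 < a → a ≤ 1 → ∀ B : ℝ, 0 < B → B ≤ (1 - a) / a → SineMimickedOn a B

/-- **Lagarias–Rodgers 2021, Theorem 1.8 (ii) (no sine-process mimicry above `(1−a)/a`,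
`a ≤ 1/2`).** "For all `0 < a ≤ 1/2`, if `B > (1−a)/a`, then the sine process cannot be mimicked at
bandwidth `[−B, B]` by a u.l.m. point process supported on `aℤ`" — for lattice processes on
probability spaces in an arbitrary universe. NAMED FACT (proof: LR21 §4.3, via the reconstruction
Theorem 2.1 above the Nyquist bandwidth). At `a = 1/2` the threshold is `B = 1` exactly
(`not_mimicsSine_half_of_one_lt`): "even a slight perturbation off this lattice spacing or
bandwidth would no longer allow for it" (§1.8). [cite: LagariasRodgers2021, Thm 1.8] -/
def lagariasRodgers2021_theorem18_ii : Prop :=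
  ∀ a : ℝ, 0 < a → a ≤ 1 / 2 → ∀ B : ℝ, (1 - a) / a < B →
    ∀ (Ω : Type u) (_ : MeasurableSpace Ω) (ℙ : Measure Ω) (N : Ω → ℤ → ℕ),
      IsULMLatticeProcess ℙ a N → ¬ MimicsSine ℙ a B N

/-- **Lagarias–Rodgers 2021, Theorem 1.8 (iii) (no sine-process mimicry at or above Nyquist for
`a > 1/2`).** "If `a > 1/2` and `B ≥ 1/(2a)`, then the sine process cannot be mimicked at bandwidth
`[−B, B]` by a u.l.m. point process supported on `aℤ`" — for lattice processes on probability
spaces in an arbitrary universe. NAMED FACT (proof: LR21 §4.4). [cite: LagariasRodgers2021, Thm 1.8] -/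
def lagariasRodgers2021_theorem18_iii : Prop :=
  ∀ a : ℝ, 1 / 2 < a → ∀ B : ℝ, 1 / (2 * a) ≤ B →
    ∀ (Ω : Type u) (_ : MeasurableSpace Ω) (ℙ : Measure Ω) (N : Ω → ℤ → ℕ),
      IsULMLatticeProcess ℙ a N → ¬ MimicsSine ℙ a B N

/-! ## §4. Proved: Corollaries 1.7 and 1.9 (from the theorems), and the `a = 1/2` knife edge -/

/-- **Lagarias–Rodgers 2021, Corollary 1.7 (Poisson mimicry at the Nyquist bandwidth).** "For each
`a > 0`, the Poisson process with intensity `λ` can be mimicked at the Nyquist bandwidth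
`[−1/(2a), 1/(2a)]` by a u.l.m. point process supported on `aℤ`" (`λ > 0`) — PROVED from
Theorem 1.6, first part, since `1/(2a) ≤ 1/a`. [cite: LagariasRodgers2021, Cor 1.7] -/
theorem lagariasRodgers2021_corollary17 (h : lagariasRodgers2021_theorem16_i) :
    ∀ lam : ℝ, 0 < lam → ∀ a : ℝ, 0 < a → PoissonMimickedOn lam a (1 / (2 * a)) := by
  intro lam hlam a ha
  refine h lam hlam a ha (1 / (2 * a)) (by positivity) ?_
  rw [div_le_div_iff₀ (by positivity) ha]
  linarith

/-- **Lagarias–Rodgers 2021, Corollary 1.9 (sine-process mimicry at the Nyquist bandwidth).** "The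
sine process can be mimicked by a u.l.m. point process supported on `aℤ` at the Nyquist bandwidth
`[−1/(2a), 1/(2a)]` if and only if `0 < a ≤ 1/2`" (for `a > 0`) — PROVED from Theorem 1.8: for
`a ≤ 1/2`, `1/(2a) ≤ (1−a)/a` and part (i) gives mimicry at the Nyquist bandwidth; for `a > 1/2`,
part (iii) with `B = 1/(2a)` forbids it (part (iii) is used at universe `0`, where the existential
lives). [cite: LagariasRodgers2021, Cor 1.9] -/
theorem lagariasRodgers2021_corollary19 (hi : lagariasRodgers2021_theorem18_i)
    (hiii : lagariasRodgers2021_theorem18_iii.{0}) :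
    ∀ a : ℝ, 0 < a → (SineMimickedOn a (1 / (2 * a)) ↔ a ≤ 1 / 2) := by
  intro a ha
  constructor
  · intro hm
    by_contra hlt
    rw [not_le] at hlt
    obtain ⟨Ω, mΩ, ℙ, N, hulm, hmim⟩ := hm
    exact hiii a hlt (1 / (2 * a)) le_rfl Ω mΩ ℙ N hulm hmim
  · intro hle
    refine hi a ha (by linarith) (1 / (2 * a)) (by positivity) ?_
    rw [div_le_div_iff₀ (by positivity) ha]
    nlinarith

/-- **The zeta case, existence side** (LR21 §1.8: `(a, B) = (1/2, 1)`): by Theorem 1.8 (i) the sine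
process IS mimicked at bandwidth `[−1, 1]` by a u.l.m. point process supported on `½ℤ` — all of
whose gaps lie in `½ℕ`. (This is the point-process form of the consistency of the Alternative
Hypothesis with bandwidth-`1` correlation information, LR 2020 Theorem 3.1.)
[cite: LagariasRodgers2021, Thm 1.8 (i) and §1.8] -/
theorem sineMimickedOn_half_one (h : lagariasRodgers2021_theorem18_i) :
    SineMimickedOn (1 / 2) 1 :=
  h (1 / 2) (by norm_num) (by norm_num) 1 one_pos (by norm_num)

/-- **The zeta case, knife-edge side**: by Theorem 1.8 (ii) at `a = 1/2` (threshold `(1−a)/a = 1`),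
for every bandwidth `B > 1` NO u.l.m. point process supported on `½ℤ` mimics the sine process at
`[−B, B]` — any sine-kernel correlation information of bandwidth strictly larger than `1` is
inconsistent with all gaps lying in `½ℕ`. [cite: LagariasRodgers2021, Thm 1.8 (ii) and §1.8] -/
theorem not_mimicsSine_half_of_one_lt (h : lagariasRodgers2021_theorem18_ii.{u}) {B : ℝ}
    (hB : 1 < B) {Ω : Type u} [MeasurableSpace Ω] (ℙ : Measure Ω) (N : Ω → ℤ → ℕ)
    (hN : IsULMLatticeProcess ℙ (1 / 2) N) : ¬ MimicsSine ℙ (1 / 2) B N := by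
  have h1 : (1 - 1 / 2) / (1 / 2 : ℝ) < B := by
    norm_num
    exact hB
  exact h (1 / 2) (by norm_num) le_rfl B h1 Ω ‹MeasurableSpace Ω› ℙ N hN

/-- Hence, given Theorem 1.8 (ii), `½ℤ` supports no mimic of the sine process at any bandwidth
`B > 1` (existential form). [cite: LagariasRodgers2021, Thm 1.8 (ii) and §1.8] -/
theorem not_sineMimickedOn_half_of_one_lt (h : lagariasRodgers2021_theorem18_ii.{0}) {B : ℝ}
    (hB : 1 < B) : ¬ SineMimickedOn (1 / 2) B := by
  rintro ⟨Ω, mΩ, ℙ, N, hulm, hmim⟩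
  exact not_mimicsSine_half_of_one_lt h hB ℙ N hulm hmim

/-! ## §5. Small API for the tuple weight and the window count -/

namespace LagariasRodgers2021

/-- For a single index (`n = 1`) the weight of the site `k 0` is its multiplicity:
`W_N(k) = N(k 0)` — the `1`-level sum counts points with multiplicity.
[cite: LagariasRodgers2021, §1.2 (1.4)] -/
theorem tupleWeight_fin_one (N : ℤ → ℕ) (k : Fin 1 → ℤ) : tupleWeight N k = N (k 0) := by
  unfold tupleWeight
  have himg : Finset.univ.image k = {k 0} := by
    ext s
    simp only [Finset.mem_image, Finset.mem_univ, true_and, Finset.mem_singleton]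
    constructor
    · rintro ⟨i, rfl⟩; rw [Subsingleton.elim i 0]
    · rintro rfl; exact ⟨0, rfl⟩
  have hfil : (Finset.univ.filter fun i : Fin 1 ↦ k i = k 0) = Finset.univ := by
    ext i; simp [Subsingleton.elim i 0]
  rw [himg, Finset.prod_singleton, hfil, Finset.card_univ, Fintype.card_fin,
    Nat.descFactorial_one]

/-- The weight of a tuple visiting an EMPTY site vanishes: if some `k i` has multiplicity `0`, then
`W_N(k) = 0` (no particle can be chosen there). [cite: LagariasRodgers2021, §1.2 (1.4)] -/
theorem tupleWeight_eq_zero_of_apply_eq_zero {n : ℕ} (N : ℤ → ℕ) (k : Fin n → ℤ) (i : Fin n)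
    (hi : N (k i) = 0) : tupleWeight N k = 0 := by
  unfold tupleWeight
  apply Finset.prod_eq_zero (Finset.mem_image_of_mem k (Finset.mem_univ i))
  rw [hi]
  apply Nat.descFactorial_of_lt
  exact Finset.card_pos.mpr ⟨i, by simp⟩

/-- A tuple using a simple site twice has weight `0`: if `k i = k j` for `i ≠ j` and that site has
multiplicity `1`, then `W_N(k) = 0` (distinct indices cannot both point to a single particle) — the
lattice form of "`Σ^{distinct}` omits the diagonal for simple configurations".
[cite: LagariasRodgers2021, §1.2 (1.4)–(1.5)] -/
theorem tupleWeight_eq_zero_of_repeat {n : ℕ} (N : ℤ → ℕ) (k : Fin n → ℤ) {i j : Fin n}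
    (hij : i ≠ j) (hk : k i = k j) (hN : N (k i) = 1) : tupleWeight N k = 0 := by
  unfold tupleWeight
  apply Finset.prod_eq_zero (Finset.mem_image_of_mem k (Finset.mem_univ i))
  rw [hN]
  apply Nat.descFactorial_of_lt
  apply Finset.one_lt_card.mpr
  exact ⟨i, by simp, j, by simp [hk], hij⟩

/-- The window count of the empty configuration is `0`. [cite: LagariasRodgers2021, §1.2 (u.l.m. condition)] -/
theorem windowCount_zero (a L : ℝ) : windowCount a (fun _ ↦ 0) L = 0 := by
  simp [windowCount]

/-- The window count is monotone in the multiplicities. [cite: LagariasRodgers2021, §1.2 (u.l.m. condition)] -/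
theorem windowCount_mono (a L : ℝ) {N N' : ℤ → ℕ} (h : ∀ k, N k ≤ N' k) :
    windowCount a N L ≤ windowCount a N' L :=
  Finset.sum_le_sum fun k _ ↦ h k

end LagariasRodgers2021

end Literature.Probability.PointProcesses
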